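import Literature.MathematicalPhysics.QuantumFieldTheory.Balaban1983to89.B1
import Literature.MathematicalPhysics.QuantumFieldTheory.Balaban1983to89.B2StepK
import Literature.MathematicalPhysics.QuantumFieldTheory.Balaban1983to89.HiggsCovariance

/-!
# `Balaban1983to89.B2Prop22Proof` — T. Bałaban, *(Higgs)₂,₃ quantum fields in a finite volume. II. An upper bound*,
# Commun. Math. Phys. **86** (1982) 555–594 [Balaban1982Higgs2]: **Proposition 2.2** (2.58) pp. 570–571 PROVED as
# its printed proof says — *"This proposition is a simple corollary of Proposition I.2.1"* — from the one-point clauses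
# (2.25)/(2.26) of [Balaban1982Higgs1] Prop. 2.1 through the dictionary `f_{y,v} = Q_k^*(A)(vδ_y)`, for r14's decl of
# record `…B2StepK.Prop22Printed` (the UNCONDITIONAL model instance `A = 0` on the nested boxes of the B4 cell is the
# sibling leaf `…B2Prop22ZeroField`)

statement-level skeleton of published theorems with citation tags; proofs where landed; nothing here is a claim about the Yang–Mills mass gap

PDF held: `paper:balaban1982-cmp86-higgs23-ii` (journal page = PDF page + 554); companion `paper:balaban1982-cmp85-higgs23-i`
(journal page = PDF page + 602).  Pages READ AS IMAGES on the ×2 renders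
`run/shared/lean/pub/pub-balaban/b2b-balaban-ref1/pages/1982-cmp86-higgs23-II/1982-cmp86-higgs23-II-p016-x2.png`,
`…-p017-x2.png` (II pp. 570–571) and `…/1982-cmp85-higgs23-I/1982-cmp85-higgs23-I-p008-x2.png` (I p. 610).

CITATION HEADER (lean-in-tree rule).  Cell `lit-balaban` (HOME `run/shared/lean/pub/lit-balaban/`), Phase-2 proof seat
**p17** gen 2 (unit `lit-balaban-p17-g2`); SKELETON row **B2.Prop2.2** (decl of record `…B2StepK.Prop22Printed`, r14
p239461 — UNCHANGED; the alternative shape `…B2Sect2Statements.Prop22Printed` of r02 is not used); kind «knitting +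
model instance» (PHASE2-TARGETS §G.1); fold owner r02, twin r14, referee ref-4.  Input statements USED BY NAME, never
restated: `…B1.Prop21Printed` / `…B1.Ineq224_225` / `…B1.Ineq226` (r-cell pub-balaban pv07; = Prop. I.2.1 (2.23)–(2.26)
pp. 610–611 over the abstract carrier `…B4.EtaSetting` of b04), `…B4.ThmPrinted` / `Ineq19_110` / `Ineq111_112`, and
the typer's concrete `…HiggsCovariance.avgQkAdj` (§2).

WHAT IS PRINTED (verbatim).  II p. 570–571 [PDF 16–17]: *"**Proposition 2.2.** Let Ω and A satisfy the assumptions of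
Proposition I.2.1, then for e(L^kε) sufficiently small there exist positive constants δ₀, c₀, R₀ independent of A, k,
Ω and depending on d, a, M, such that |(D^η_AG_k(Ω, A)Q_k^*(A))(b, y)| ≦ c₀ exp(−δ₀ dist(b, y)),  (2.58)  for b ⊂ Ω,
dist(b, Ωᶜ) ≧ R₀, y ∈ Ω^{(k)}. The identical inequality holds for G_k(Ω, A)Q_k^*(A), and for D^η_AδG_k(Ω,Ω₀, A)Q_k^*(A),
δG_k(Ω,Ω₀, A)Q_k^*(A) with the additional factor exp(−δ₀(dist(b,Ωᶜ) + dist(y,Ωᶜ))).  This proposition is a simple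
corollary of Proposition I.2.1."*  I p. 610 [PDF 8] (Prop. 2.1, the clauses used): *"Then for e(L^kε) sufficiently small
and α < 1 there exist positive constants δ₀, c₀, R₀ independent of A, k, Ω and depending on d, a, M only, c₀ on α also,
such that for an arbitrary function f : Ω → R^N we have […] |(D^η_{A,μ}G_k(Ω, A)f)(x)|, |(G_k(Ω, A)f)(x)| ≦
c₀ exp(−δ₀ dist(x, supp f))‖f‖_∞  (2.25)  for x ∈ Ω, dist(x, Ωᶜ) ≧ R₀. If Ω ⊂ Ω₀, then for δG_k(Ω, Ω₀, A) defined by the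
equality δG_k(Ω, Ω₀, A) = G_k(Ω, A) − G_k(Ω₀, A),  (2.26)  we have the inequalities (2.24), (2.25) with the additional
factor exp(−δ₀ dist(supp f, Ωᶜ) − δ₀ dist({x, x′}, Ωᶜ))"*.  The dictionary behind "simple corollary" (I (2.11) p. 609,
(2.20) p. 610, II p. 570): the kernel of `T Q_k^*(A)` (`T` = one of the four operators) at `(·, y)` is `T` applied to the
source `f_{y,v} = Q_k^*(A)(vδ_y)`, `(Q_k^*(A)ψ)(x) = U(A(Γ^{(k)}_{x_k,x}))*ψ(x_k)` (weight `1` for the scalar products (1.5)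
of `T_η` and of the unit lattice `T_1^{(k)}`), so `supp f_{y,v} ⊆ B^k(y)`, `‖f_{y,v}‖_∞ ≤ |v|` (the transports are
unitary, I p. 605), `dist(b, y) ≤ dist(b₋, supp f_{y,v}) + diam B^k(y)` and `dist(y, Ωᶜ) ≤ dist(supp f_{y,v}, Ωᶜ) +
diam B^k(y)`, `diam B^k(y) < 1` in the η-scaled sup-distance.

WHAT IS PROVED (kernel-checked, zero `sorry`, no new `def … : Prop`; axioms standard).
* §1 (`Dict`, `Dict.toP22`, **`prop22Printed_of_onePoint`**): for EVERY family of dictionary instances — an instance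
  `(k, Ω ⊂ Ω₀, A, e)` of Prop. I.2.1 in the carrier `B4.EtaSetting`, the points `y ∈ Ω^{(k)}`, the bonds `b ⊂ Ω` with
  their base points `b₋` and directions, nonempty test vectors `v`, sources `f_{y,v}` with `‖f_{y,v}‖_∞ ≤ 1`,
  `dist(x,y) ≤ dist(x, supp f_{y,v}) + D`, `dist(y,Ωᶜ) ≤ dist(supp f_{y,v},Ωᶜ) + D`, `dist(b,y) ≤ dist(b₋,y)`,
  `dist(b,Ωᶜ) ≤ dist(b₋,Ωᶜ)` (one allowance `D ≥ 0` for the family), the kernels of (2.58) being the suprema over `v` of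
  the operator values at `f_{y,v}` — ONE α-clause of `B1.Prop21Printed` (its one-point conjuncts (2.25), (2.26) only)
  yields `B2StepK.Prop22Printed` for the linked `P22Setting` family, with the SAME `δ₀, R₀`, threshold `e₁`, and
  `c₀ ↦ c₀e^{2δ₀D}`; corollaries `prop22Printed_of_prop21Printed` (hypothesis `B1.Prop21Printed`, α := 0),
  `prop22Printed_of_thmPrinted` (hypothesis `B4.ThmPrinted`, via `B1.prop21Printed_iff_thmPrinted`),
  `prop22Printed_of_B4clause` (hypothesis: one α-clause in b04's spelling `Ineq19_110 ∧ Ineq111_112`, via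
  `B1.ineq226_iff_ineq111_112`).
* §2 (the dictionary facts at the genuine (Higgs)₂,₃ carriers, any `A`, any `N`): for the tree's CONCRETE
  `Q_k^*(A) = HiggsCovariance.avgQkAdj C A k` — `avgQkAdj_apply`, `norm_avgQkAdj_apply` (`|(Q_k^*(A)ψ)(x)| = |ψ(x_k)|`,
  unitarity of the transports), `avgQkAdj_single_of_ne` (`Q_k^*(A)(vδ_y)` vanishes off `B^k(y)`),
  `norm_avgQkAdj_single_le` (`‖Q_k^*(A)(vδ_y)(x)‖ ≤ ‖v‖`).
* The sibling leaf `…B2Prop22ZeroField` (same seat) instantiates §1 with NO hypothesis: `B2StepK.Prop22Printed` on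
  the B4 sub-cell's zero-field nested boxes (`A = 0`, `f_y = 1_{B^k(y)}`), from the PROVED α = 0 clause
  `…B4ThmZeroNestAlphaZero.ineq_zero_nestFamB`.
NOT CLAIMED: Proposition I.2.1 itself (an INPUT, as in print), the identification of an abstract `EtaSetting` with
Bałaban's `G_k(Ω, A)` for `A ≠ 0` (no such concrete carrier exists in the tree yet — §2 supplies the two facts such a
carrier needs for the dictionary), anything about `e(L^kε)`-smallness beyond passing the threshold through.
-/

namespace Literature.MathematicalPhysics.QuantumFieldTheory.Balaban1983to89.B2Prop22Proof

open Literature.MathematicalPhysics.QuantumFieldTheory.Balaban1983to89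

noncomputable section

/-! ## §0. Two lines of real arithmetic: shifting a decay estimate by a bounded distance defect -/

/-- `e^{−δs} ≤ e^{δD}·e^{−δt}` when `t ≤ s + D`, `δ ≥ 0`. [folklore] -/
private theorem exp_shift {δ s t D : ℝ} (hδ : 0 ≤ δ) (h : t ≤ s + D) :
    Real.exp (-(δ * s)) ≤ Real.exp (δ * D) * Real.exp (-(δ * t)) := by
  rw [← Real.exp_add, Real.exp_le_exp]
  have := mul_le_mul_of_nonneg_left h hδ
  rw [mul_add] at this
  linarith

/-- The arithmetic of *"a simple corollary of Proposition I.2.1"* for the plain clauses of (2.58): a one-point bound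
`V ≤ c e^{−δs} N` at a source with `N = ‖f‖_∞ ≤ 1` and `dist ≥ t − D` (`t ≤ s + D`) gives `V ≤ c e^{2δD} e^{−δt}`
(`c, δ, D ≥ 0`; also used by the sibling leaf `…B2Prop22ZeroField`). [cite: Balaban1982Higgs2, Prop. 2.2 (2.58) p.571] -/
theorem bound_plain {V c δ s t D N : ℝ} (hc : 0 ≤ c) (hδ : 0 ≤ δ) (hD : 0 ≤ D)
    (hV : V ≤ c * Real.exp (-(δ * s)) * N) (hN : N ≤ 1) (hst : t ≤ s + D) :
    V ≤ c * Real.exp (2 * δ * D) * Real.exp (-(δ * t)) := by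
  have h1 : V ≤ c * Real.exp (-(δ * s)) := hV.trans (mul_le_of_le_one_right (by positivity) hN)
  have h2 : Real.exp (-(δ * s)) ≤ Real.exp (δ * D) * Real.exp (-(δ * t)) := exp_shift hδ hst
  have h3 : Real.exp (δ * D) ≤ Real.exp (2 * δ * D) := Real.exp_le_exp.2 (by nlinarith)
  calc V ≤ c * Real.exp (-(δ * s)) := h1
    _ ≤ c * (Real.exp (δ * D) * Real.exp (-(δ * t))) := mul_le_mul_of_nonneg_left h2 hc
    _ ≤ c * (Real.exp (2 * δ * D) * Real.exp (-(δ * t))) :=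
        mul_le_mul_of_nonneg_left (mul_le_mul_of_nonneg_right h3 (Real.exp_pos _).le) hc
    _ = c * Real.exp (2 * δ * D) * Real.exp (-(δ * t)) := by ring

/-- the δG clauses: `V ≤ c e^{−δs} N e^{−δb_S − δb₁}`, `N ≤ 1`, `t ≤ s + D`, `y_d ≤ b_S + D`, `b_B ≤ b₁` ⟹
`V ≤ c e^{2δD} e^{−δt} e^{−δ(b_B + y_d)}` (`c, δ, D ≥ 0`). [folklore] -/
private theorem bound_delta {V c δ s t D N bS b1 bB yd : ℝ} (hc : 0 ≤ c) (hδ : 0 ≤ δ)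
    (hV : V ≤ c * Real.exp (-(δ * s)) * N * Real.exp (-(δ * bS) - δ * b1)) (hN : N ≤ 1)
    (hst : t ≤ s + D) (hyd : yd ≤ bS + D) (hbB : bB ≤ b1) :
    V ≤ c * Real.exp (2 * δ * D) * Real.exp (-(δ * t)) * Real.exp (-(δ * (bB + yd))) := by
  have h1 : V ≤ c * Real.exp (-(δ * s)) * Real.exp (-(δ * bS) - δ * b1) := by
    refine hV.trans ?_
    have : c * Real.exp (-(δ * s)) * N * Real.exp (-(δ * bS) - δ * b1)
        = (c * Real.exp (-(δ * s)) * Real.exp (-(δ * bS) - δ * b1)) * N := by ring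
    rw [this]
    exact mul_le_of_le_one_right (by positivity) hN
  have h2 : Real.exp (-(δ * s)) ≤ Real.exp (δ * D) * Real.exp (-(δ * t)) := exp_shift hδ hst
  have h3 : Real.exp (-(δ * bS) - δ * b1) ≤ Real.exp (δ * D) * Real.exp (-(δ * (bB + yd))) := by
    rw [← Real.exp_add, Real.exp_le_exp]
    have e1 := mul_le_mul_of_nonneg_left hyd hδ
    have e2 := mul_le_mul_of_nonneg_left hbB hδ
    rw [mul_add] at e1
    rw [mul_add]
    linarith
  calc V ≤ c * Real.exp (-(δ * s)) * Real.exp (-(δ * bS) - δ * b1) := h1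
    _ ≤ c * (Real.exp (δ * D) * Real.exp (-(δ * t))) * (Real.exp (δ * D) * Real.exp (-(δ * (bB + yd)))) :=
        mul_le_mul (mul_le_mul_of_nonneg_left h2 hc) h3 (Real.exp_pos _).le (by positivity)
    _ = c * Real.exp (2 * δ * D) * Real.exp (-(δ * t)) * Real.exp (-(δ * (bB + yd))) := by
        rw [show (2 : ℝ) * δ * D = δ * D + δ * D by ring, Real.exp_add]; ring

/-! ## §1. The dictionary `f_{y,v} = Q_k^*(A)(vδ_y)` and Prop. 2.2 ⇐ Prop. I.2.1 -/

/-- ONE DICTIONARY INSTANCE behind *"This proposition is a simple corollary of Proposition I.2.1"* (II p. 571): an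
instance `S = (k, Ω ⊂ Ω₀, A, e)` of Prop. I.2.1 in b04's carrier `B4.EtaSetting` (its fields NAME `|(D^η_{A,μ}G_k(Ω,A)f)(x)|`,
`|(G_k(Ω,A)f)(x)|`, their δG versions, `dist(x, supp f)`, `dist(x, Ωᶜ)`, `dist(supp f, Ωᶜ)`, `‖f‖_∞`), together with:
the points `y ∈ Ω^{(k)}` (`KSite`); the bonds `b ⊂ Ω` (`Bond`) with base point `b₋` (`base`) and direction (`dir`);
nonempty test vectors `v` (`V`, the unit ball of `R^N`); the sources `src y v = f_{y,v} = Q_k^*(A)(vδ_y)` — the column `y`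
of the kernel of `TQ_k^*(A)` is `T f_{y,·}` (I (2.11), (2.20): `(Q_k^*(A)ψ)(x) = U(A(Γ^{(k)}_{x_k,x}))*ψ(x_k)`, weight 1);
the printed distances `dist(x,y)` (`dxy`), `dist(b,y)` (`dby`), `dist(b,Ωᶜ)` (`bdistB`), `dist(y,Ωᶜ)` (`ydist`); and the
five facts that make the corollary "simple", with ONE allowance `D ≥ 0` for the family (= the η-diameter of a block
`B^k(y)`, `< 1`): `‖f_{y,v}‖_∞ ≤ 1` (unitary transports, I p. 605), `dist(x,y) ≤ dist(x, supp f_{y,v}) + D` and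
`dist(y,Ωᶜ) ≤ dist(supp f_{y,v},Ωᶜ) + D` (`supp f_{y,v} ⊆ B^k(y) ∋ y`), `dist(b,y) ≤ dist(b₋,y)`, `dist(b,Ωᶜ) ≤ dist(b₋,Ωᶜ)`
(a set containing `b₋` is at most as far as `b₋`).  PROVED instances: `…B2Prop22ZeroField` (`A = 0`, nested boxes); the
two analytic facts at the genuine carriers: §2. [cite: Balaban1982Higgs2, Prop. 2.2 p.571] -/
structure Dict (D : ℝ) where
  /-- the instance `(k, Ω ⊂ Ω₀, A, e)` of Prop. I.2.1 -/
  S : B4.EtaSetting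
  /-- the points `y ∈ Ω^{(k)}` -/
  KSite : Type
  /-- the bonds `b ⊂ Ω` -/
  Bond : Type
  /-- `b₋` -/
  base : Bond → S.Site
  /-- the direction `μ` of `b = ⟨b₋, b₋ + ηe_μ⟩` -/
  dir : Bond → S.Dir
  /-- there is at least one lattice direction (`d ≥ 1`) -/
  hDir : Nonempty S.Dir
  /-- test vectors `v`, `|v| ≤ 1` -/
  V : Type
  hV : Nonempty V
  /-- `f_{y,v} = Q_k^*(A)(vδ_y)` -/
  src : KSite → V → S.Src
  /-- `dist(x, y)` -/
  dxy : S.Site → KSite → ℝ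
  /-- `dist(b, y)` -/
  dby : Bond → KSite → ℝ
  /-- `dist(b, Ωᶜ)` -/
  bdistB : Bond → ℝ
  /-- `dist(y, Ωᶜ)` -/
  ydist : KSite → ℝ
  supNorm_src : ∀ y v, S.supNorm (src y v) ≤ 1
  dxy_le : ∀ x y v, dxy x y ≤ S.sdist1 x (src y v) + D
  ydist_le : ∀ y v, ydist y ≤ S.bdistS (src y v) + D
  dby_le : ∀ b y, dby b y ≤ dxy (base b) y
  bdistB_le : ∀ b, bdistB b ≤ S.bdist1 (base b)

/-- The instance of r14's carrier `B2StepK.P22Setting` LINKED to a dictionary instance: same `e`, `regular`, `bigBlocks`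
(*"Let Ω and A satisfy the assumptions of Proposition I.2.1"*), `dist(x,Ωᶜ)` = the carrier's `bdist1`, the printed
distances, and the four kernels of (2.58) as the suprema over the test vectors of the operator values at the sources:
`|(D^η_AG_kQ_k^*)(b,y)| = sup_v |(D^η_{A,μ(b)}G_k f_{y,v})(b₋)|`, `|(G_kQ_k^*)(x,y)| = sup_v |(G_k f_{y,v})(x)|`, and the two
δG versions. [cite: Balaban1982Higgs2, Prop. 2.2 (2.58) pp.570–571] -/
def Dict.toP22 {D : ℝ} (𝔇 : Dict D) : B2StepK.P22Setting where
  Bond := 𝔇.Bond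
  Site := 𝔇.S.Site
  KSite := 𝔇.KSite
  e := 𝔇.S.e
  regular := 𝔇.S.regular
  bigBlocks := 𝔇.S.bigBlocks
  bdist := 𝔇.bdistB
  xdist := 𝔇.S.bdist1
  ydist := 𝔇.ydist
  dby := 𝔇.dby
  dxy := 𝔇.dxy
  kDGQ := fun b y => ⨆ v, 𝔇.S.valDG (𝔇.dir b) (𝔇.src y v) (𝔇.base b)
  kGQ := fun x y => ⨆ v, 𝔇.S.valG (𝔇.src y v) x
  kdDGQ := fun b y => ⨆ v, 𝔇.S.dvalDG (𝔇.dir b) (𝔇.src y v) (𝔇.base b)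
  kdGQ := fun x y => ⨆ v, 𝔇.S.dvalG (𝔇.src y v) x

/-- **PROPOSITION 2.2 ⇐ ONE α-CLAUSE OF PROPOSITION I.2.1** (the printed proof, II p. 571: *"This proposition is a
simple corollary of Proposition I.2.1"*).  For every family of dictionary instances with allowance `D ≥ 0`: if for some
`α` there are `δ₀, c₀, R₀, e₁ > 0` such that every member meeting the antecedents of Prop. I.2.1 (`regular`, `bigBlocks`,
`0 < e ≤ e₁`) satisfies (2.24)–(2.25) (`B1.Ineq224_225`) and their δG versions (2.26) (`B1.Ineq226`), then r14's typed
Prop. 2.2 `B2StepK.Prop22Printed` holds for the linked family with the constants `δ₀, c₀e^{2δ₀D}, R₀, e₁`.  Mechanism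
(only the ONE-POINT conjuncts (2.25)/(2.26) are used): at the source `f_{y,v}`, `|(Tf_{y,v})(b₋)| ≤
c₀e^{−δ₀dist(b₋, supp f_{y,v})}‖f_{y,v}‖_∞ ≤ c₀e^{δ₀D}e^{−δ₀dist(b,y)}`, and the δG factor `e^{−δ₀dist(supp f,Ωᶜ) −
δ₀dist(b₋,Ωᶜ)} ≤ e^{δ₀D}e^{−δ₀(dist(b,Ωᶜ) + dist(y,Ωᶜ))}`; the restriction `dist(b,Ωᶜ) ≥ R₀` implies the printed
`dist(b₋,Ωᶜ) ≥ R₀`; then the supremum over `v`. [cite: Balaban1982Higgs2, Prop. 2.2 (2.58) pp.570–571] -/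
theorem prop22Printed_of_onePoint {I : Type} {D : ℝ} (hD : 0 ≤ D) (𝔇 : I → Dict D) (α : ℝ)
    (h : ∃ δ₀ c₀ R₀ e₁ : ℝ, 0 < δ₀ ∧ 0 < c₀ ∧ 0 < R₀ ∧ 0 < e₁ ∧ ∀ i : I,
      (𝔇 i).S.regular → (𝔇 i).S.bigBlocks → 0 < (𝔇 i).S.e → (𝔇 i).S.e ≤ e₁ →
        B1.Ineq224_225 (𝔇 i).S α δ₀ c₀ R₀ ∧ B1.Ineq226 (𝔇 i).S α δ₀ c₀ R₀) :
    B2StepK.Prop22Printed (fun i => (𝔇 i).toP22) := by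
  obtain ⟨δ₀, c₀, R₀, e₁, hδ, hc, hR, he, h⟩ := h
  refine ⟨δ₀, c₀ * Real.exp (2 * δ₀ * D), R₀, e₁, hδ, by positivity, hR, he, fun i hreg hbig he0 he1 => ?_⟩
  obtain ⟨h25, h26⟩ := h i hreg hbig he0 he1
  have h25' := h25.2
  have h26' := h26.2
  haveI := (𝔇 i).hV
  dsimp only [Dict.toP22]
  refine ⟨fun b y hb => ?_, fun x y hx => ?_, fun b y hb => ?_, fun x y hx => ?_⟩
  · refine ciSup_le fun v => ?_
    have hpt := (h25' ((𝔇 i).dir b) ((𝔇 i).src y v) ((𝔇 i).base b)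
      (Or.inr (hb.trans ((𝔇 i).bdistB_le b)))).1
    exact bound_plain hc.le hδ.le hD hpt ((𝔇 i).supNorm_src y v)
      (((𝔇 i).dby_le b y).trans ((𝔇 i).dxy_le _ y v))
  · refine ciSup_le fun v => ?_
    have hpt := (h25' (𝔇 i).hDir.some ((𝔇 i).src y v) x (Or.inr hx)).2
    exact bound_plain hc.le hδ.le hD hpt ((𝔇 i).supNorm_src y v) ((𝔇 i).dxy_le x y v)
  · refine ciSup_le fun v => ?_
    have hpt := (h26' ((𝔇 i).dir b) ((𝔇 i).src y v) ((𝔇 i).base b)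
      (Or.inr (hb.trans ((𝔇 i).bdistB_le b)))).1
    exact bound_delta hc.le hδ.le hpt ((𝔇 i).supNorm_src y v)
      (((𝔇 i).dby_le b y).trans ((𝔇 i).dxy_le _ y v)) ((𝔇 i).ydist_le y v) ((𝔇 i).bdistB_le b)
  · refine ciSup_le fun v => ?_
    have hpt := (h26' (𝔇 i).hDir.some ((𝔇 i).src y v) x (Or.inr hx)).2
    exact bound_delta hc.le hδ.le hpt ((𝔇 i).supNorm_src y v) ((𝔇 i).dxy_le x y v)
      ((𝔇 i).ydist_le y v) le_rfl

/-- **PROPOSITION 2.2 ⇐ PROPOSITION I.2.1** as typed: the cell's `B1.Prop21Printed` (all `α < 1`) for the family of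
Prop. I.2.1 instances yields r14's `B2StepK.Prop22Printed` for the linked family (the clause at `α = 0` is used).
[cite: Balaban1982Higgs2, Prop. 2.2 (2.58) pp.570–571] -/
theorem prop22Printed_of_prop21Printed {I : Type} {D : ℝ} (hD : 0 ≤ D) (𝔇 : I → Dict D)
    (h : B1.Prop21Printed (fun i => (𝔇 i).S)) : B2StepK.Prop22Printed (fun i => (𝔇 i).toP22) :=
  prop22Printed_of_onePoint hD 𝔇 0 (h 0 zero_lt_one)

/-- The same from b04's typed leaf `B4.ThmPrinted` (B4 p. 573 «Theorem (Proposition 2.1 of [1])» = Prop. I.2.1; the two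
typings agree, `B1.prop21Printed_iff_thmPrinted`). [cite: Balaban1982Higgs2, Prop. 2.2 (2.58) pp.570–571] -/
theorem prop22Printed_of_thmPrinted {I : Type} {D : ℝ} (hD : 0 ≤ D) (𝔇 : I → Dict D)
    (h : B4.ThmPrinted (fun i => (𝔇 i).S)) : B2StepK.Prop22Printed (fun i => (𝔇 i).toP22) :=
  prop22Printed_of_prop21Printed hD 𝔇 ((B1.prop21Printed_iff_thmPrinted _).2 h)

/-- The same from ONE α-clause in b04's spelling `Ineq19_110 ∧ Ineq111_112` (the form in which the B4 sub-cell proves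
clauses on concrete carriers; `B1.ineq226_iff_ineq111_112`). [cite: Balaban1982Higgs2, Prop. 2.2 (2.58) pp.570–571] -/
theorem prop22Printed_of_B4clause {I : Type} {D : ℝ} (hD : 0 ≤ D) (𝔇 : I → Dict D) (α : ℝ)
    (h : ∃ δ₀ c₀ R₀ e₁ : ℝ, 0 < δ₀ ∧ 0 < c₀ ∧ 0 < R₀ ∧ 0 < e₁ ∧ ∀ i : I,
      (𝔇 i).S.regular → (𝔇 i).S.bigBlocks → 0 < (𝔇 i).S.e → (𝔇 i).S.e ≤ e₁ →
        B4.Ineq19_110 (𝔇 i).S α δ₀ c₀ R₀ ∧ B4.Ineq111_112 (𝔇 i).S α δ₀ c₀ R₀) :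
    B2StepK.Prop22Printed (fun i => (𝔇 i).toP22) := by
  obtain ⟨δ₀, c₀, R₀, e₁, hδ, hc, hR, he, h⟩ := h
  exact prop22Printed_of_onePoint hD 𝔇 α ⟨δ₀, c₀, R₀, e₁, hδ, hc, hR, he, fun i h1 h2 h3 h4 =>
    ⟨(h i h1 h2 h3 h4).1, (B1.ineq226_iff_ineq111_112 _ _ _ _ _).2 (h i h1 h2 h3 h4).2⟩⟩

/-! ## §2. The two analytic dictionary facts at the genuine (Higgs)₂,₃ carriers (`Q_k^*(A)`, any `A`, any `N`) -/

section Higgs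

open Literature.MathematicalPhysics.QuantumFieldTheory.Balaban1983to89.HiggsLattice Literature.MathematicalPhysics.QuantumFieldTheory.Balaban1983to89.HiggsAveraging
  Literature.MathematicalPhysics.QuantumFieldTheory.Balaban1983to89.HiggsCovariance

variable {P : Params} {N : ℕ}

/-- `(Q_k^*(A)ψ)(x) = U(A(Γ^{(k)}_{x_k,x}))* ψ(x_k)` — the tree's concrete adjoint, unfolded. [cite: Balaban1982Higgs1, (2.20) p.610] -/
theorem avgQkAdj_apply (C : ChargeData N) (A : VecField P 0) (k : ℕ) (ψ : ScalarField P k N) (x : Site P 0) :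
    avgQkAdj C A k ψ x = star (C.U (P.mesh 0) (multiContourSum A k x)) (ψ (blockIter k x)) := rfl

/-- the transports are unitary (I p. 605): `|(Q_k^*(A)ψ)(x)| = |ψ(x_k)|`. [cite: Balaban1982Higgs1, (2.11) p.609] -/
theorem norm_avgQkAdj_apply (C : ChargeData N) (A : VecField P 0) (k : ℕ) (ψ : ScalarField P k N) (x : Site P 0) :
    ‖avgQkAdj C A k ψ x‖ = ‖ψ (blockIter k x)‖ := by
  rw [avgQkAdj_apply]
  exact ContinuousLinearMap.norm_map_of_mem_unitary (Unitary.star_mem (C.U_mem_unitary _ _)) _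

/-- **`supp Q_k^*(A)(vδ_y) ⊆ B^k(y)`**: the source of the dictionary vanishes at every `x` with `x_k ≠ y`.
[cite: Balaban1982Higgs2, Prop. 2.2 p.571] -/
theorem avgQkAdj_single_of_ne (C : ChargeData N) (A : VecField P 0) (k : ℕ) (y : Site P k)
    (v : EuclideanSpace ℝ (Fin N)) {x : Site P 0} (hx : blockIter k x ≠ y) :
    avgQkAdj C A k (Pi.single y v) x = 0 := by
  rw [avgQkAdj_apply, Pi.single_eq_of_ne hx, map_zero]

/-- **`‖Q_k^*(A)(vδ_y)‖_∞ ≤ |v|`**: the source of the dictionary has sup norm at most `|v|` (`≤ 1` on the unit ball).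
[cite: Balaban1982Higgs2, Prop. 2.2 p.571] -/
theorem norm_avgQkAdj_single_le (C : ChargeData N) (A : VecField P 0) (k : ℕ) (y : Site P k)
    (v : EuclideanSpace ℝ (Fin N)) (x : Site P 0) : ‖avgQkAdj C A k (Pi.single y v) x‖ ≤ ‖v‖ := by
  rw [norm_avgQkAdj_apply]
  by_cases hx : blockIter k x = y
  · rw [hx, Pi.single_eq_same]
  · rw [Pi.single_eq_of_ne hx, norm_zero]
    exact norm_nonneg _

end Higgs

end

end Literature.MathematicalPhysics.QuantumFieldTheory.Balaban1983to89.B2Prop22Proof
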